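import Literature.NumberTheory.Rogawski1990.FinExplicitTransferFactorDeepTauUniform     -- ★ p845350∕p845389 (F0P3a-p04 (g15)) T5-u, the UNRAMIFIED twin: `galAdicCompletionMap_finTauArg_apply`, `galAdicCompletionMap_det_mul_det_eq_one`, `eventually_nhds_one_valued_sub_one_le`
import Literature.NumberTheory.Rogawski1990.RankOneUnstableDeltaValueRamified           -- ★ R-4 (A-p19 (g23)): `localComponent_map_toPlace_eq_hilbertSymbol` (`μ_w(ι_w β) = (β, θ)_v` under the guard, NO ramification hypothesis)
import HarnessLib

/-!
# `τ_v(γ_H) = (β(γ_H), θ)_v` for EVERY deep `γ_H ∈ H_v` at a TAME non-split place (`|2|_w = 1`), RAMIFIED ALLOWED — all torus types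
# ([Rogawski1990] §4.9 p. 55, Lemma 4.9.3 p. 56, Prop. 8.1.3 p. 116; [LabesseLanglands1979] §2; [Serre1979] Ch. X §1, Ch. XIV §3)

Topic `NumberTheory/Rogawski1990`; namespace `Literature.NumberTheory.Rogawski1990`.  THEOREMS ONLY (no definition, no instance, no notation, no named fact, no `sorry`).
Cell `pub/hodgecm-mathlib` (D-0151), crux H413 = `stmt-HodgeConjecture-24833`, line «N6nsGerm», last open stub `stub_N6nsS3id`; road «S3-tree» (architect A-p16 census v3
0ca147ac, A-50 depth coordinates; chair WORD T10-2 (B) SCOPE «unramified + tame now»), brick **T5-u-TAME** (T5 lineage F0P3a-p04 (g16)): the `τ_v`-half of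
`Δ‴_v = τ_v·D_{G∕H,v}·κ_v` (★ `FinExplicitTransferFactor`) for DEEP `γ_H`, UNIFORM IN THE TORUS TYPE, at a non-split place `v ∤ 2` of `L⁺` that MAY BE RAMIFIED in `L` —
the open T5 cell «type (2) × tame ramified `v`» of the T5 holder's state line (bus 2026-09-01T16:20Z).  TAME twin of ★ `FinExplicitTransferFactorDeepTauUniform` (there:
`v` unramified in `L`, value `(−1)^n`).  ROAD-INDEPENDENT (a statement about ★ `finTau` ∕ ★ `finExplicitDelta` alone).  HONEST LABEL: HC_CM is proved only modulo the printed
citations (2 remaining named inputs hLiu418, h413) until rung 0 closes; nothing printed is asserted here.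

THE MATHEMATICS (`v` non-split in `L`, `w ∣ v`, `σ = σ_w`, `ι = ι_w : L⁺_v → L_w`, `ϖ = ι ϖ_v`, `|2|_w = 1`, guard `μ|_{𝕀_{L⁺}} = ω_{L∕L⁺}`, `θ` the CM generator,
`(·, θ)_v` the local Hilbert symbol = the quadratic character of `L_w∕L⁺_v`).  `τ_v(γ_H) = μ_w(u_w)·μ_w(y)⁻¹`, `y = −χ_g(u)_w∕det g_w` (★ `finTau_eq_localComponent_of_nonsplit`),
and unitarity gives `σ y = y·r` with the norm-one unit `r = det g_w∕u_w²` (★ `galAdicCompletionMap_finTauArg_apply`), DEEP when `γ_H` is.  HILBERT 90 NEAR `1` WITH THE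
TRACE-ONE ELEMENT `t = 1∕2` (available because `|2|_w = 1`; the unramified twin used ★ I-4b's integral trace-one element instead): `s := (1 + r)∕2 ∈ 1 + ϖ^{M₀}𝒪_w` has
`σ s = r⁻¹ s`, so `f := y·s` is `σ`-FIXED, `f = ι β` with `β ∈ L⁺_vˣ`, and under the guard `μ_w(ι β) = (β, θ)_v` for EVERY `β` (★ `localComponent_map_toPlace_eq_hilbertSymbol`,
★ `quadraticHeckeChar_localUnits`), `μ_w(s) = 1` (★ `exists_forall_localComponent_eq_one_of_valued_sub_one_le`).  Hence **`μ_w(y) = (β, θ)_v`** and, `u_w` being a deep unit,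
**`τ_v(γ_H) = (β(γ_H), θ)_v`** with the `σ`-fixed «SYMMETRISED DISCRIMINANT» `ι β(γ_H) = y(1 + r)∕2 = −χ_g(u)_w·(u_w² + det g_w)∕(2·u_w²·det g_w) = −½·Tr_{L_w∕L⁺_v}(χ_g(u)_w∕u_w²)`.
NO ramification hypothesis and NO torus frame enter.  At an unramified `v ∤ 2` this reproduces ★ T5-u (`(β, θ)_v = (−1)^{ord_v β} = (−1)^{ord_w χ_g(u)}`, units are norms);
at a (tamely) RAMIFIED `v` the value is the genuine sheet sign `(β, θ)_v` — `ord_w χ_g(u) = ord_w(ι β) = 2·ord_v β` is then EVEN and `(β, θ)_v = (ϖ_v, θ)_v^{ord_v β}·(β₀, θ)_v`,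
`(β₀, θ)_v` the Legendre symbol of the unit part `β₀ mod v` (★ `hilbertSymbol_coe_eq_one_iff_isSquare_residue_of_odd`, not evaluated here).  The `D`-half is uniform at every
non-split place: `e(w|v)·f(w|v) = 2` (★ `ramificationIdx_mul_inertiaDeg_eq_two_of_smul_eq`) gives `‖ι ϖ_v‖_w = q_v^{−2}`, so `|χ_g(u)_w|_w = |ι ϖ_v|_w^m ⇒ D_{G∕H,v}(γ_H) = q_v^{−m}`
(★ `sqrt_prod_norm_eq_inv_pow` without its `hunr`), and on matched pairs **`Δ‴_v(γ_H, γ′) = (β(γ_H), θ)_v · q_v^{−m} · κ_v(γ_H, γ′)`**.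

* §1 CORE-tame `localComponent_eq_hilbertSymbol_of_toPlace_eq` (`ι β = y(1+r)∕2` ⇒ `μ_w(y) = (β, θ)_v`), `exists_units_toPlace_eq_mul_half_one_add` (such `β` exist).
* §2 HEAD **`exists_forall_finTau_eq_hilbertSymbol_of_deep`** (`τ_v(γ_H) = (β, θ)_v`), `exists_units_toPlace_eq_symmDisc_of_deep` (the symmetrised discriminant is from `L⁺_v`).
* Sequel file `FinExplicitTransferFactorDeepTauTamePairs`: `D_{G∕H,v} = q_v^{−m}` at every non-split place, the matched-pair value `Δ‴_v = (β, θ)_v·q_v^{−m}·κ_v` and its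
  germ form `∃ V ∈ 𝓝 1, ∀ γ_H ∈ V, …` (the END contract's «GEN» currency).

## References
* [Rogawski1990] J. D. Rogawski, *Automorphic Representations of Unitary Groups in Three Variables* (1990): §4.9 p. 55 (`τ`, `D_{G∕H}`, `μ|_{F^×} = ω_{E∕F}`), Lemma 4.9.3
  (4.9.2) p. 56 (the ramified torus), Prop. 8.1.3 p. 116.
* [LabesseLanglands1979] J.-P. Labesse, R. P. Langlands, *L-indistinguishability for SL(2)*, Canad. J. Math. 31 (1979): §2, (2.1)–(2.2) (ramified torus weight `κ(bϖ^{−m})`).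
* [Serre1979] J.-P. Serre, *Local Fields*, GTM 67: Ch. X §1 (Hilbert 90), Ch. XIV §3 (the local symbol `(·, θ)_v`).
* [NeukirchANT1999] J. Neukirch, *Algebraic Number Theory* (1999): Ch. I §8 Prop. 8.2 (`e f g = n`), Ch. II §6 (`‖·‖_w = (N𝔓_w)^{−ord_w}`).
-/

set_option autoImplicit false

noncomputable section

open NumberField IsDedekindDomain Filter Topology Matrix

namespace Literature.NumberTheory.Rogawski1990

open Literature.NumberTheory.Automorphic Literature.NumberTheory.Automorphic.UnitaryGroup Literature.NumberTheory.GaloisRepresentations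
open Literature.NumberTheory.QuadraticForms

variable (L : Type) [Field L] [NumberField L] [IsCMField L] (v : HeightOneSpectrum (𝓞 ↥(maximalRealSubfield L)))
  (w : PlacesOver L v) (hw : IsCMField.complexConj L • w.1 = w.1)

/-! ## §0 Two valuation helpers: `ι_w ϖ_v ≠ 0`, `|ι_w ϖ_v^M|_w < 1` (`M ≥ 1`) — at any `w ∣ v` -/

section Helpers

omit [IsCMField L] in
/-- `ι_w ϖ_v ≠ 0` (`|ι_w ϖ_v|_w = |ϖ_v|_v^{e(w|v)} = exp(−e) ≠ 0`). [cite: NeukirchANT1999, Ch. II §6] -/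
theorem toPlace_heckeUniformizer_ne_zero :
    (toPlace v w (HeckeCharacter.uniformizer ↥(maximalRealSubfield L) v : v.adicCompletion ↥(maximalRealSubfield L))) ≠ 0 := by
  haveI := PlacesOver.liesOver w
  intro h0
  have h := congrArg (Valued.v : w.1.adicCompletion L → _) h0
  rw [valued_toPlace, HeckeCharacter.valued_uniformizer, map_zero] at h
  exact (pow_ne_zero _ WithZero.coe_ne_zero) h

omit [IsCMField L] in
/-- `|ι_w ϖ_v^M|_w < 1` for `M ≥ 1` (`|ι_w ϖ_v|_w = |ϖ_v|_v^{e(w|v)} < 1`, `e ≥ 1`). [cite: NeukirchANT1999, Ch. II §6] -/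
theorem valued_toPlace_heckeUniformizer_pow_lt_one {M : ℕ} (hM : 1 ≤ M) :
    Valued.v ((toPlace v w (HeckeCharacter.uniformizer ↥(maximalRealSubfield L) v : v.adicCompletion ↥(maximalRealSubfield L))) ^ M) < 1 := by
  haveI := PlacesOver.liesOver w
  have h1 : Valued.v (toPlace v w (HeckeCharacter.uniformizer ↥(maximalRealSubfield L) v : v.adicCompletion ↥(maximalRealSubfield L))) < 1 := by
    rw [valued_toPlace, HeckeCharacter.valued_uniformizer]
    exact pow_lt_one₀ zero_le (by rw [← WithZero.exp_zero]; exact WithZero.exp_lt_exp.2 (by norm_num))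
      (Ideal.IsDedekindDomain.ramificationIdx'_ne_zero_of_liesOver w.1.asIdeal v.ne_bot)
  rw [Valuation.map_pow]
  exact pow_lt_one₀ zero_le h1 (by omega)

end Helpers

/-! ## §1 CORE-tame: `μ_w(y) = (β, θ)_v` for `y` that is `σ`-fixed up to a deep norm-one unit, `β` its symmetrisation -/

section Core

variable (μ : HeckeCharacter L)
  (hμω : ∀ x : ideleGroup ↥(maximalRealSubfield L), μ (AdeleRing.ideleBaseChange ↥(maximalRealSubfield L) L x) = quadraticHeckeCharCM L x)

include hw hμω in
/-- **CORE-tame.**  At a non-split place with `|2|_w = 1`, under the guard, with `M₀ ≥ 1` a level on which `μ_w` is trivial (`hM₀`): if `y ≠ 0`, `|r − 1|_w ≤ |ϖ^{M₀}|_w`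
and `β ∈ L⁺_vˣ` has `ι_w β = y·(1 + r)∕2`, then **`μ_w(y) = (β, θ)_v`** (`s := (1+r)∕2` is a unit with `|s − 1| = |r − 1|`, `μ_w(s) = 1`, `y = ι_w β · s⁻¹`, and
`μ_w(ι_w β) = (β, θ)_v` ★).  The identity needs no `σ`-hypothesis — those only make `β` EXIST (`exists_units_toPlace_eq_mul_half_one_add`).  TAME twin of ★
`localComponent_eq_neg_one_pow_of_galAdicCompletionMap_eq_mul`. [cite: Rogawski1990, §4.9 p. 55; Lemma 4.9.3 (4.9.2) p. 56] [cite: Serre1979, Ch. XIV §3] -/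
theorem localComponent_eq_hilbertSymbol_of_toPlace_eq (h2 : Valued.v (2 : w.1.adicCompletion L) = 1)
    {M₀ : ℕ} (hM₁ : 1 ≤ M₀) (hM₀ : ∀ (s : w.1.adicCompletion L) (hs : s ≠ 0),
      Valued.v (s - 1) ≤ Valued.v ((toPlace v w (HeckeCharacter.uniformizer ↥(maximalRealSubfield L) v : v.adicCompletion ↥(maximalRealSubfield L))) ^ M₀) →
      μ.localComponent w.1 (Units.mk0 s hs) = 1)
    {y r : w.1.adicCompletion L} (hy0 : y ≠ 0)
    (hrd : Valued.v (r - 1) ≤ Valued.v ((toPlace v w (HeckeCharacter.uniformizer ↥(maximalRealSubfield L) v : v.adicCompletion ↥(maximalRealSubfield L))) ^ M₀))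
    (β : (v.adicCompletion ↥(maximalRealSubfield L))ˣ) (hβ : toPlace v w (β : v.adicCompletion ↥(maximalRealSubfield L)) = y * ((1 + r) / 2)) :
    ((μ.localComponent w.1 (Units.mk0 y hy0) : ℂˣ) : ℂ) =
      (hilbertSymbol (v.adicCompletion ↥(maximalRealSubfield L)) (β : v.adicCompletion ↥(maximalRealSubfield L))
        (algebraMap ↥(maximalRealSubfield L) _ ((cmQuadraticGenerator L : 𝓞 ↥(maximalRealSubfield L)) : ↥(maximalRealSubfield L))) : ℂ) := by
  classical
  set ϖ : w.1.adicCompletion L := toPlace v w (HeckeCharacter.uniformizer ↥(maximalRealSubfield L) v : v.adicCompletion ↥(maximalRealSubfield L)) with hϖdef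
  have hϖM1 : Valued.v (ϖ ^ M₀) < 1 := valued_toPlace_heckeUniformizer_pow_lt_one L v w hM₁
  have h20 : (2 : w.1.adicCompletion L) ≠ 0 := fun h0 => by rw [h0, map_zero] at h2; exact zero_ne_one h2
  -- `s := (1 + r)/2`, a deep unit
  set s : w.1.adicCompletion L := (1 + r) / 2 with hsdef
  have hs1 : s - 1 = (r - 1) / 2 := by rw [hsdef]; field_simp; ring
  have hsv1 : Valued.v (s - 1) ≤ Valued.v (ϖ ^ M₀) := by
    rw [hs1, Valuation.map_div, h2, div_one]; exact hrd
  have hsvlt : Valued.v (s - 1) < 1 := lt_of_le_of_lt hsv1 hϖM1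
  have hvs : Valued.v s = 1 := by
    have h := Valuation.map_one_add_of_lt (Valued.v : Valuation (w.1.adicCompletion L) _) hsvlt
    rwa [add_sub_cancel] at h
  have hs0 : s ≠ 0 := fun h0 => by rw [h0, map_zero] at hvs; exact zero_ne_one hvs
  have hμs : μ.localComponent w.1 (Units.mk0 s hs0) = 1 := hM₀ s hs0 hsv1
  -- `y = ι β · s⁻¹`
  have hyu : Units.mk0 y hy0 =
      Units.map (toPlace v w : v.adicCompletion ↥(maximalRealSubfield L) →* w.1.adicCompletion L) β * (Units.mk0 s hs0)⁻¹ :=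
    Units.ext (by rw [Units.val_mul, Units.val_inv_eq_inv_val, Units.val_mk0, Units.val_mk0, Units.coe_map, MonoidHom.coe_coe, hβ, mul_inv_cancel_right₀ hs0])
  rw [hyu, map_mul, map_inv, hμs, inv_one, mul_one, localComponent_map_toPlace_eq_hilbertSymbol L v w hw μ hμω β]

include hw in
/-- **THE SYMMETRISATION COMES FROM `L⁺_v`.**  If `y ≠ 0`, `σ_w y = y·r` with `σ_w r · r = 1` and `|r − 1|_w ≤ |ϖ^{M₀}|_w < 1 = |2|_w` (`M₀ ≥ 1`), then `y·(1 + r)∕2 ≠ 0` is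
`σ_w`-fixed (`σ((1+r)∕2) = (1 + r⁻¹)∕2 = r⁻¹(1+r)∕2`), hence `= ι_w β` for a (unique) `β ∈ L⁺_vˣ` (★ `exists_toPlace_eq_of_galAdicCompletionMap_eq`: at a non-split place the
`σ_w`-fixed elements come from `L⁺_v`).  Hilbert 90 near `1` with the trace-one element `1∕2`. [cite: Serre1979, Ch. X §1] [cite: Rogawski1990, §4.9 p. 55] -/
theorem exists_units_toPlace_eq_mul_half_one_add (h2 : Valued.v (2 : w.1.adicCompletion L) = 1)
    {M₀ : ℕ} (hM₁ : 1 ≤ M₀) {y r : w.1.adicCompletion L} (hy0 : y ≠ 0)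
    (hσy : galAdicCompletionMap (L := L) (IsCMField.complexConj L) hw y = y * r)
    (hr : galAdicCompletionMap (L := L) (IsCMField.complexConj L) hw r * r = 1)
    (hrd : Valued.v (r - 1) ≤ Valued.v ((toPlace v w (HeckeCharacter.uniformizer ↥(maximalRealSubfield L) v : v.adicCompletion ↥(maximalRealSubfield L))) ^ M₀)) :
    ∃ β : (v.adicCompletion ↥(maximalRealSubfield L))ˣ, toPlace v w (β : v.adicCompletion ↥(maximalRealSubfield L)) = y * ((1 + r) / 2) := by
  classical
  have hc1 : IsCMField.complexConj L ≠ 1 := IsCMField.complexConj_ne_one L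
  set σ := galAdicCompletionMap (L := L) (IsCMField.complexConj L) hw with hσdef
  set ϖ : w.1.adicCompletion L := toPlace v w (HeckeCharacter.uniformizer ↥(maximalRealSubfield L) v : v.adicCompletion ↥(maximalRealSubfield L)) with hϖdef
  have hϖM1 : Valued.v (ϖ ^ M₀) < 1 := valued_toPlace_heckeUniformizer_pow_lt_one L v w hM₁
  have h20 : (2 : w.1.adicCompletion L) ≠ 0 := fun h0 => by rw [h0, map_zero] at h2; exact zero_ne_one h2
  -- `r` is a unit with `σ r = r⁻¹`, and `1 + r ≠ 0`
  have hvr1 : Valued.v (r - 1) < 1 := lt_of_le_of_lt hrd hϖM1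
  have hvr : Valued.v r = 1 := by
    have h := Valuation.map_one_add_of_lt (Valued.v : Valuation (w.1.adicCompletion L) _) hvr1
    rwa [add_sub_cancel] at h
  have hr0 : r ≠ 0 := fun h0 => by rw [h0, map_zero] at hvr; exact zero_ne_one hvr
  have hσr : σ r = r⁻¹ := eq_inv_of_mul_eq_one_left hr
  have h1r : 1 + r ≠ 0 := by
    intro h
    have hr' : r - 1 = -2 := by linear_combination h
    rw [hr', Valuation.map_neg, h2] at hvr1
    exact lt_irrefl _ hvr1
  -- `σ` fixes `y (1 + r)/2`
  have hσ2 : σ 2 = 2 := map_ofNat σ 2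
  have hfix : σ (y * ((1 + r) / 2)) = y * ((1 + r) / 2) := by
    rw [map_mul, map_div₀, map_add, map_one, hσ2, hσy, hσr]
    field_simp
    ring
  obtain ⟨p, hp⟩ := exists_toPlace_eq_of_galAdicCompletionMap_eq (IsCMField.complexConj L) w hc1 hw _ hfix
  have hp0 : p ≠ 0 := by
    intro h0
    rw [h0, map_zero] at hp
    exact mul_ne_zero hy0 (div_ne_zero h1r h20) hp.symm
  exact ⟨Units.mk0 p hp0, by rw [Units.val_mk0, hp]⟩

end Core

/-! ## §2 HEAD: `τ_v(γ_H) = (β(γ_H), θ)_v` for every deep `γ_H`, `β(γ_H)` the symmetrised discriminant -/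

section Head

variable (μ : HeckeCharacter L)
  (hμω : ∀ x : ideleGroup ↥(maximalRealSubfield L), μ (AdeleRing.ideleBaseChange ↥(maximalRealSubfield L) L x) = quadraticHeckeCharCM L x)

include hw hμω in
/-- **HEAD (T5-u-TAME) — `τ_v(γ_H) = (β(γ_H), θ)_v` FOR EVERY DEEP `γ_H`, ALL TORUS TYPES, AT A TAME NON-SPLIT PLACE (RAMIFIED ALLOWED).**  At a non-split place `v` of `L⁺`
(`w ∣ v`) with `|2|_w = 1`, for a Hecke character `μ` with print's guard `μ|_{𝕀_{L⁺}} = ω_{L∕L⁺}`, there is a level `M₀ ≥ 1` such that for every `γ_H = (g, u) ∈ H_v` with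
`χ_g(u)_w ≠ 0` (`(G,H)`-regularity at `w`), `|u_w − 1|_w ≤ |ι_w ϖ_v|_w^{M₀}`, `|det g_w − 1|_w ≤ |ι_w ϖ_v|_w^{M₀}`, and every `β ∈ L⁺_vˣ` with
`ι_w β = −χ_g(u)_w·(u_w² + det g_w)∕(2·u_w²·det g_w)` (the `σ_w`-fixed symmetrised discriminant; such `β` exist, `exists_units_toPlace_eq_symmDisc_of_deep`):
**`τ_v(γ_H) = (β, θ)_v`**, `θ` the CM generator, `(·, θ)_v` the local Hilbert symbol (= `ω_{L_w∕L⁺_v}`). [cite: Rogawski1990, §4.9 p. 55; Lemma 4.9.3 (4.9.2) p. 56;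
Prop. 8.1.3 p. 116] [cite: LabesseLanglands1979, §2 (2.1)–(2.2)] -/
theorem exists_forall_finTau_eq_hilbertSymbol_of_deep (h2 : Valued.v (2 : w.1.adicCompletion L) = 1) :
    ∃ M₀ : ℕ, 1 ≤ M₀ ∧
      ∀ (γH : (cmDatum L 2 (Matrix.of fun i j : Fin 2 => if i.val + j.val + 1 = 2 then (1 : L) else 0)).Local v ×
          (cmDatum L 1 (Matrix.of fun i j : Fin 1 => if i.val + j.val + 1 = 1 then (1 : L) else 0)).Local v),
        ((finCharpolyTwo L v γH).eval (finGammaTwo L v γH)) w ≠ 0 →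
        Valued.v (finGammaTwo L v γH w - 1) ≤
          Valued.v ((toPlace v w (HeckeCharacter.uniformizer ↥(maximalRealSubfield L) v : v.adicCompletion ↥(maximalRealSubfield L))) ^ M₀) →
        Valued.v (((γH.1.val.val : Matrix (Fin 2) (Fin 2) (LocalRing L v)).map
            (Pi.evalRingHom (fun w' : PlacesOver L v => w'.1.adicCompletion L) w)).det - 1) ≤
          Valued.v ((toPlace v w (HeckeCharacter.uniformizer ↥(maximalRealSubfield L) v : v.adicCompletion ↥(maximalRealSubfield L))) ^ M₀) →
        ∀ β : (v.adicCompletion ↥(maximalRealSubfield L))ˣ,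
          toPlace v w (β : v.adicCompletion ↥(maximalRealSubfield L)) =
            -(((finCharpolyTwo L v γH).eval (finGammaTwo L v γH)) w *
                (finGammaTwo L v γH w ^ 2 +
                  ((γH.1.val.val : Matrix (Fin 2) (Fin 2) (LocalRing L v)).map (Pi.evalRingHom (fun w' : PlacesOver L v => w'.1.adicCompletion L) w)).det)) /
              (2 * finGammaTwo L v γH w ^ 2 *
                ((γH.1.val.val : Matrix (Fin 2) (Fin 2) (LocalRing L v)).map (Pi.evalRingHom (fun w' : PlacesOver L v => w'.1.adicCompletion L) w)).det) →
          finTau L v γH μ =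
            (hilbertSymbol (v.adicCompletion ↥(maximalRealSubfield L)) (β : v.adicCompletion ↥(maximalRealSubfield L))
              (algebraMap ↥(maximalRealSubfield L) _ ((cmQuadraticGenerator L : 𝓞 ↥(maximalRealSubfield L)) : ↥(maximalRealSubfield L))) : ℂ) := by
  classical
  haveI : Algebra.IsQuadraticExtension ↥(maximalRealSubfield L) L := IsCMField.isQuadraticExtension L
  have hc1 : IsCMField.complexConj L ≠ 1 := IsCMField.complexConj_ne_one L
  haveI hv : Subsingleton (PlacesOver L v) := PlacesOver.subsingleton_of_smul_eq (IsCMField.complexConj L) hc1 w hw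
  obtain ⟨M₀, hM₁, hM₀⟩ := exists_forall_localComponent_eq_one_of_valued_sub_one_le L v w μ
  refine ⟨M₀, hM₁, fun γH hχ0 hud hdd β hβ => ?_⟩
  set σ := galAdicCompletionMap (L := L) (IsCMField.complexConj L) hw with hσdef
  set ϖ : w.1.adicCompletion L := toPlace v w (HeckeCharacter.uniformizer ↥(maximalRealSubfield L) v : v.adicCompletion ↥(maximalRealSubfield L)) with hϖdef
  set u := finGammaTwo L v γH w with hudef
  set χw := ((finCharpolyTwo L v γH).eval (finGammaTwo L v γH)) w with hχwdef
  set d := ((γH.1.val.val : Matrix (Fin 2) (Fin 2) (LocalRing L v)).map (Pi.evalRingHom (fun w' : PlacesOver L v => w'.1.adicCompletion L) w)).det with hddef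
  have hϖM1 : Valued.v (ϖ ^ M₀) < 1 := valued_toPlace_heckeUniformizer_pow_lt_one L v w hM₁
  have h20 : (2 : w.1.adicCompletion L) ≠ 0 := fun h0 => by rw [h0, map_zero] at h2; exact zero_ne_one h2
  -- units: `u`, `d`
  have hσu : σ u * u = 1 := by
    have h := congrArg (fun y : LocalRing L v => y w) (conjLocal_finGammaTwo_mul_finGammaTwo L v γH)
    simpa only [Pi.mul_apply, Pi.one_apply, conjLocal_apply_eq_galAdicCompletionMap L v w hw] using h
  have hσd : σ d * d = 1 := galAdicCompletionMap_det_mul_det_eq_one L v w hw γH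
  have hvu : Valued.v u = 1 := by
    have hlt : Valued.v (u - 1) < 1 := lt_of_le_of_lt hud hϖM1
    have h := Valuation.map_one_add_of_lt (Valued.v : Valuation (w.1.adicCompletion L) _) hlt
    rwa [add_sub_cancel] at h
  have hu0 : u ≠ 0 := fun h0 => by rw [h0, map_zero] at hvu; exact zero_ne_one hvu
  have hvd : Valued.v d = 1 := by
    have hlt : Valued.v (d - 1) < 1 := lt_of_le_of_lt hdd hϖM1
    have h := Valuation.map_one_add_of_lt (Valued.v : Valuation (w.1.adicCompletion L) _) hlt
    rwa [add_sub_cancel] at h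
  have hd0 : d ≠ 0 := fun h0 => by rw [h0, map_zero] at hvd; exact zero_ne_one hvd
  have hχu : IsUnit ((finCharpolyTwo L v γH).eval (finGammaTwo L v γH)) := by
    refine isUnit_localRing_of_ne_zero_of_subsingleton L v hv fun h0 => hχ0 ?_
    rw [hχwdef, h0, Pi.zero_apply]
  -- `τ = μ_w(u) · μ_w(y)⁻¹`, `y = t_w`
  rw [finTau_eq_localComponent_of_nonsplit L v γH w hw μ hχu]
  have hy : finTauArg L v γH w = -χw * d⁻¹ := finTauArg_apply L v γH w
  have hy0 : finTauArg L v γH w ≠ 0 := by rw [hy]; exact mul_ne_zero (neg_ne_zero.2 hχ0) (inv_ne_zero hd0)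
  have hunitu : MulEquiv.piUnits (isUnit_finGammaTwo L v γH).unit w = Units.mk0 u hu0 := Units.ext rfl
  have hunity : MulEquiv.piUnits (isUnit_finTauArg_of_isUnit L v γH hχu).unit w = Units.mk0 (finTauArg L v γH w) hy0 := Units.ext rfl
  rw [hunitu, hunity, hM₀ u hu0 hud, Units.val_one, one_mul]
  -- the core with `r := d / u²`: `ι β = y (1 + r)/2`
  have hrd : Valued.v (d / u ^ 2 - 1) ≤ Valued.v (ϖ ^ M₀) := by
    have hsub : d / u ^ 2 - 1 = (d - 1 - (u - 1) * (u + 1)) / u ^ 2 := by field_simp; ring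
    rw [hsub, Valuation.map_div, Valuation.map_pow, hvu, one_pow, div_one]
    refine le_trans (Valuation.map_sub _ _ _) (max_le hdd ?_)
    rw [Valuation.map_mul]
    calc Valued.v (u - 1) * Valued.v (u + 1) ≤ Valued.v (ϖ ^ M₀) * 1 := by
          gcongr
          exact le_trans (Valuation.map_add _ _ _) (max_le hvu.le (le_of_eq (Valuation.map_one _)))
      _ = Valued.v (ϖ ^ M₀) := mul_one _
  have hβ' : toPlace v w (β : v.adicCompletion ↥(maximalRealSubfield L)) = finTauArg L v γH w * ((1 + d / u ^ 2) / 2) := by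
    rw [hβ, hy]
    field_simp
  rw [localComponent_eq_hilbertSymbol_of_toPlace_eq L v w hw μ hμω h2 hM₁ hM₀ hy0 hrd β hβ']
  -- `(β, θ)_v = ±1` is its own inverse
  rcases hilbertSymbol_eq_one_or_eq_neg_one (β : v.adicCompletion ↥(maximalRealSubfield L))
      (algebraMap ↥(maximalRealSubfield L) _ ((cmQuadraticGenerator L : 𝓞 ↥(maximalRealSubfield L)) : ↥(maximalRealSubfield L))) with h | h <;>
    simp [h]

include hw in
/-- **THE SYMMETRISED DISCRIMINANT OF A DEEP `γ_H` COMES FROM `L⁺_v`**: at a non-split place with `|2|_w = 1` there is `M₀ ≥ 1` (any `M₀ ≥ 1` works) such that for every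
`γ_H = (g, u)` with `χ_g(u)_w ≠ 0`, `|u_w − 1|_w, |det g_w − 1|_w ≤ |ι_w ϖ_v|_w^{M₀}` there is `β ∈ L⁺_vˣ` with `ι_w β = −χ_g(u)_w·(u_w² + det g_w)∕(2·u_w²·det g_w)`
(`σ_w y = y·det g_w∕u_w²` for `y = −χ_g(u)_w∕det g_w` ★ `galAdicCompletionMap_finTauArg_apply`, and §1). [cite: Rogawski1990, §4.9 p. 55] [cite: Serre1979, Ch. X §1] -/
theorem exists_units_toPlace_eq_symmDisc_of_deep (h2 : Valued.v (2 : w.1.adicCompletion L) = 1) {M₀ : ℕ} (hM₁ : 1 ≤ M₀)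
    (γH : (cmDatum L 2 (Matrix.of fun i j : Fin 2 => if i.val + j.val + 1 = 2 then (1 : L) else 0)).Local v ×
      (cmDatum L 1 (Matrix.of fun i j : Fin 1 => if i.val + j.val + 1 = 1 then (1 : L) else 0)).Local v)
    (hχ0 : ((finCharpolyTwo L v γH).eval (finGammaTwo L v γH)) w ≠ 0)
    (hud : Valued.v (finGammaTwo L v γH w - 1) ≤
      Valued.v ((toPlace v w (HeckeCharacter.uniformizer ↥(maximalRealSubfield L) v : v.adicCompletion ↥(maximalRealSubfield L))) ^ M₀))
    (hdd : Valued.v (((γH.1.val.val : Matrix (Fin 2) (Fin 2) (LocalRing L v)).map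
        (Pi.evalRingHom (fun w' : PlacesOver L v => w'.1.adicCompletion L) w)).det - 1) ≤
      Valued.v ((toPlace v w (HeckeCharacter.uniformizer ↥(maximalRealSubfield L) v : v.adicCompletion ↥(maximalRealSubfield L))) ^ M₀)) :
    ∃ β : (v.adicCompletion ↥(maximalRealSubfield L))ˣ,
      toPlace v w (β : v.adicCompletion ↥(maximalRealSubfield L)) =
        -(((finCharpolyTwo L v γH).eval (finGammaTwo L v γH)) w *
            (finGammaTwo L v γH w ^ 2 +
              ((γH.1.val.val : Matrix (Fin 2) (Fin 2) (LocalRing L v)).map (Pi.evalRingHom (fun w' : PlacesOver L v => w'.1.adicCompletion L) w)).det)) /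
          (2 * finGammaTwo L v γH w ^ 2 *
            ((γH.1.val.val : Matrix (Fin 2) (Fin 2) (LocalRing L v)).map (Pi.evalRingHom (fun w' : PlacesOver L v => w'.1.adicCompletion L) w)).det) := by
  classical
  set σ := galAdicCompletionMap (L := L) (IsCMField.complexConj L) hw with hσdef
  set ϖ : w.1.adicCompletion L := toPlace v w (HeckeCharacter.uniformizer ↥(maximalRealSubfield L) v : v.adicCompletion ↥(maximalRealSubfield L)) with hϖdef
  set u := finGammaTwo L v γH w with hudef
  set χw := ((finCharpolyTwo L v γH).eval (finGammaTwo L v γH)) w with hχwdef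
  set d := ((γH.1.val.val : Matrix (Fin 2) (Fin 2) (LocalRing L v)).map (Pi.evalRingHom (fun w' : PlacesOver L v => w'.1.adicCompletion L) w)).det with hddef
  have hϖM1 : Valued.v (ϖ ^ M₀) < 1 := valued_toPlace_heckeUniformizer_pow_lt_one L v w hM₁
  have hσu : σ u * u = 1 := by
    have h := congrArg (fun y : LocalRing L v => y w) (conjLocal_finGammaTwo_mul_finGammaTwo L v γH)
    simpa only [Pi.mul_apply, Pi.one_apply, conjLocal_apply_eq_galAdicCompletionMap L v w hw] using h
  have hσd : σ d * d = 1 := galAdicCompletionMap_det_mul_det_eq_one L v w hw γH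
  have hvu : Valued.v u = 1 := by
    have hlt : Valued.v (u - 1) < 1 := lt_of_le_of_lt hud hϖM1
    have h := Valuation.map_one_add_of_lt (Valued.v : Valuation (w.1.adicCompletion L) _) hlt
    rwa [add_sub_cancel] at h
  have hu0 : u ≠ 0 := fun h0 => by rw [h0, map_zero] at hvu; exact zero_ne_one hvu
  have hvd : Valued.v d = 1 := by
    have hlt : Valued.v (d - 1) < 1 := lt_of_le_of_lt hdd hϖM1
    have h := Valuation.map_one_add_of_lt (Valued.v : Valuation (w.1.adicCompletion L) _) hlt
    rwa [add_sub_cancel] at h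
  have hd0 : d ≠ 0 := fun h0 => by rw [h0, map_zero] at hvd; exact zero_ne_one hvd
  have hy : finTauArg L v γH w = -χw * d⁻¹ := finTauArg_apply L v γH w
  have hy0 : finTauArg L v γH w ≠ 0 := by rw [hy]; exact mul_ne_zero (neg_ne_zero.2 hχ0) (inv_ne_zero hd0)
  have hσy : σ (finTauArg L v γH w) = finTauArg L v γH w * (d / u ^ 2) := galAdicCompletionMap_finTauArg_apply L v w hw γH
  have hr : σ (d / u ^ 2) * (d / u ^ 2) = 1 := by
    rw [map_div₀, map_pow]
    have h1 : σ d = d⁻¹ := eq_inv_of_mul_eq_one_left hσd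
    have h2' : σ u = u⁻¹ := eq_inv_of_mul_eq_one_left hσu
    rw [h1, h2']
    field_simp
  have hrd : Valued.v (d / u ^ 2 - 1) ≤ Valued.v (ϖ ^ M₀) := by
    have hsub : d / u ^ 2 - 1 = (d - 1 - (u - 1) * (u + 1)) / u ^ 2 := by field_simp; ring
    rw [hsub, Valuation.map_div, Valuation.map_pow, hvu, one_pow, div_one]
    refine le_trans (Valuation.map_sub _ _ _) (max_le hdd ?_)
    rw [Valuation.map_mul]
    calc Valued.v (u - 1) * Valued.v (u + 1) ≤ Valued.v (ϖ ^ M₀) * 1 := by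
          gcongr
          exact le_trans (Valuation.map_add _ _ _) (max_le hvu.le (le_of_eq (Valuation.map_one _)))
      _ = Valued.v (ϖ ^ M₀) := mul_one _
  obtain ⟨β, hβ⟩ := exists_units_toPlace_eq_mul_half_one_add L v w hw h2 hM₁ hy0 hσy hr hrd
  refine ⟨β, ?_⟩
  rw [hβ, hy]
  field_simp

end Head

end Literature.NumberTheory.Rogawski1990

end
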